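import Summits.ValiantsHypothesis.ValiantsHypothesis.Theorems.NewtonUnitEquationsTwoProductsRankOneFourLawSlice
import HarnessLib

/-!
# Route NewtonUnitEquations — crux `TwoProducts` (stmt-ValiantsHypothesis-5906), line `relation_ladder`, rung R6 (four-term
# rank one): the SEGRE LIFT — the PROVED SPLIT `BinExpPencilCount → RankOneFourLaw` — part 4/6 — the planar instance: rank-one coincidences, relation data, the refined push-forward and injectivity (Part T6, first half)

(T6) `RankOneCoincidences A ρ⁺ ρ⁻` (all additive coincidences of the letter family `A` are, on letter multisets, multiples of the one relation
`ρ⁺ ~ ρ⁻`; the permutation-type case `rankOneCoincidences_of_permType`; a relation letter outside the alphabet forces `PermType`,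
`permType_of_absent_letter`), the relation data `RelData u v` of a visible configuration (`idxOf`, `enum_idxOf`, `RelData.idx/enum_*`), the
REFINED planar push-forward `E'` (`ℕ²`-Riesz: `α⊓γ, β⊓δ, α-α⊓γ, γ-α⊓γ`; `piE_E'_segM`, `piE_E'_piT`, `phi E' ∘ phiT segM = phi enum` as
`phi_E'_phiT`), the tail difference `GT` (`phi_GT`, `exists_of_mem_support_GT`), INJECTIVITY of `piE E'` on `supp GT` from rank-one coincidences
(`injOn_of_rankOne`) and the lifted visible point `lifted_of_visible`.

PORT NOTE (val-lit-p11 g1, literature-prover seat, helper mode `--supports stmt-ValiantsHypothesis-5906 --as helper`, no stub credit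
claimed): part 4/6 of a VERBATIM Theorems-side port of val-idea-8 g3's sorry-free module
`Cruxes/TwoProducts/Lines/relation_ladder_R6.lean` (tree @1dcc86cce347; file sha256 36828fc46563…; 1 653 lines; `lean check` rc 0, 0 sorries)
into files of ≤ 400 lines, as tasked by the val-lit desk (RULING #273 (b)). ALL mathematics and ALL proofs below are val-idea-8 g3's (engine
memo `Cruxes/TwoProducts/Lines/relation_ladder_R6_engine.md` rev 3); the port changes only: the file split, the import chain, two deprecated
Mathlib names (`Finsupp.coe_finset_sum` → `Finsupp.coe_finsetSum`, `Finsupp.finset_sum_apply` → `Finsupp.finsetSum_apply`), `omit […] in`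
annotations and one-line docstrings on 45 API lemmas required by the tree's zero-warning / docstring lint. Namespace = the author's
(`…Theorems.NewtonUnitEquations.TwoProducts.PermutationType`, as in the R3♯ port `…PermutationType{WeightOrder,Lifted,PushForward,Count,Family}`).
Nothing here closes the line's residual, the crux `TwoProducts` (5906) or `VP ≠ VNP`; no summit statement is proved.

Cut table: in the module docstring of part 1/6 (`…RankOneFourLawToric`); this file = source l. 867–1146.

Honest scope (the author's): shapes `α = β + γ` (R6b), `2β = α + γ` (R6c) and coincidence rank `≥ 2` (R7) are NOT covered and go to the
residual of skeleton v14. Nothing here moves VP ≠ VNP; `TwoProducts` (5906) stays OPEN. [folklore]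
-/

noncomputable section

-- Sub = Summit single-conjunct layout: the duplicated namespace component is mandated by the tree.
set_option linter.dupNamespace false
set_option linter.unusedSimpArgs false

namespace Summit.ValiantsHypothesis.ValiantsHypothesis.Theorems.NewtonUnitEquations.TwoProducts.PermutationType
open scoped BigOperators
open MvPolynomial

variable {σ : Type*} [Fintype σ] [DecidableEq σ]

variable (I : FourIdx σ)

/-! ## Part T6: the planar instance — relation data, the refined planar push-forward `E'`, injectivity from rank-one
coincidences, and the upstairs weights -/

section SegrePlanar
open Summit.ValiantsHypothesis.ValiantsHypothesis.Theorems.NewtonUnitEquations.TwoProducts.FormalLogLinearisation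
open Summit.ValiantsHypothesis.ValiantsHypothesis.Theorems.NewtonUnitEquations.TwoProducts.PlanarCell

variable {m : ℕ}

/-- **Rank-one coincidences** of a letter family (verbatim the R6 sketch's `RankOneCoincidences`): every additive coincidence of
two tuples is, at the level of letter multisets, a multiple of the one relation `ρ⁺ ~ ρ⁻`. [folklore] -/
def RankOneCoincidences (A : Fin m → Finset Expo) (ρp ρm : Expo →₀ ℕ) : Prop :=
  ∀ a ∈ tuples A, ∀ b ∈ tuples A, ∑ j, a j = ∑ j, b j →
    ∃ k : ℕ, msetT a + k • ρp = msetT b + k • ρm ∨ msetT b + k • ρp = msetT a + k • ρm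

omit [Fintype σ] [DecidableEq σ] in
/-- Permutation type is the case `k = 0`. [folklore] -/
theorem rankOneCoincidences_of_permType (A : Fin m → Finset Expo) (h : PermType A) (ρp ρm : Expo →₀ ℕ) :
    RankOneCoincidences A ρp ρm := fun a ha b hb hab => ⟨0, Or.inl (by simpa using h a ha b hb hab)⟩

omit [Fintype σ] [DecidableEq σ] in
/-- Letters of a tuple lie in the family. [folklore] -/
theorem msetT_apply_eq_zero (A : Fin m → Finset Expo) (a : Fin m → Expo) (ha : a ∈ tuples A) (e : Expo)
    (he : ∀ j, e ∉ A j) : msetT a e = 0 := by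
  classical
  unfold msetT
  rw [Finsupp.finsetSum_apply]
  refine Finset.sum_eq_zero fun j _ => ?_
  by_cases h0 : a j = 0
  · rw [if_pos h0]; rfl
  · rw [if_neg h0, Finsupp.single_apply, if_neg]
    intro hje
    have hmem := Fintype.mem_piFinset.1 ha j
    rw [Finset.mem_insert] at hmem
    rcases hmem with h | h
    · exact h0 h
    · exact he j (hje ▸ h)

omit [Fintype σ] [DecidableEq σ] in
/-- **Degenerate relations.** If one of the four relation letters is absent from the family, rank-one coincidences for the
four-term relation are already of permutation type. [folklore] -/
theorem permType_of_absent_letter (A : Fin m → Finset Expo) (α β γ δ : Expo) (hab : α ≠ β) (hac : α ≠ γ) (had : α ≠ δ)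
    (hbc : β ≠ γ) (hbd : β ≠ δ) (hcd : γ ≠ δ)
    (hR : RankOneCoincidences A (Finsupp.single γ 1 + Finsupp.single δ 1) (Finsupp.single α 1 + Finsupp.single β 1))
    (e : Expo) (he : e = α ∨ e = β ∨ e = γ ∨ e = δ) (hnot : ∀ j, e ∉ A j) : PermType A := by
  intro a ha b hb hab'
  obtain ⟨k, hk⟩ := hR a ha b hb hab'
  have ha0 := msetT_apply_eq_zero A a ha e hnot
  have hb0 := msetT_apply_eq_zero A b hb e hnot
  have hk0 : k = 0 := by
    rcases hk with hk | hk <;>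
    · have h1 := DFunLike.congr_fun hk e
      simp only [Finsupp.add_apply, Finsupp.smul_apply, smul_eq_mul, Finsupp.single_apply, ha0, hb0] at h1
      rcases he with rfl | rfl | rfl | rfl <;>
        simp [hab, hac, had, hbc, hbd, hcd, hab.symm, hac.symm, had.symm, hbc.symm, hbd.symm, hcd.symm] at h1 <;> omega
  subst hk0
  simp only [zero_smul, add_zero] at hk
  rcases hk with hk | hk
  · exact hk
  · exact hk.symm

variable (u v : Fin m → MvPolynomial (Fin 2) ℂ)

/-- The index of a tail letter. [folklore] -/
def idxOf (e : Expo) (he : e ∈ tailSupport u v) : Fin (sE u v) := (tailSupport u v).equivFin ⟨e, he⟩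

omit [Fintype σ] [DecidableEq σ] in
/-- `enum` inverts `idxOf` on the tail support. [folklore] -/
theorem enum_idxOf (e : Expo) (he : e ∈ tailSupport u v) : enum u v (idxOf u v e he) = e := by
  unfold enum idxOf
  rw [Equiv.symm_apply_apply]

/-- **Planar four-term relation data**: distinct tail letters `α, β, γ, δ` with `α + β = γ + δ`. [folklore] -/
structure RelData where
  /-- the letter `α` -/
  α : Expo
  /-- the letter `β` -/
  β : Expo
  /-- the letter `γ` -/
  γ : Expo
  /-- the letter `δ` -/
  δ : Expo
  hα : α ∈ tailSupport u v
  hβ : β ∈ tailSupport u v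
  hγ : γ ∈ tailSupport u v
  hδ : δ ∈ tailSupport u v
  hab : α ≠ β
  hac : α ≠ γ
  had : α ≠ δ
  hbc : β ≠ γ
  hbd : β ≠ δ
  hcd : γ ≠ δ
  hrel : α + β = γ + δ

variable {u v}
variable (D : RelData u v)

/-- The four indices of the relation letters. [folklore] -/
def RelData.idx : FourIdx (Fin (sE u v)) where
  a := idxOf u v D.α D.hα
  b := idxOf u v D.β D.hβ
  c := idxOf u v D.γ D.hγ
  d := idxOf u v D.δ D.hδ
  hab h := D.hab (by have := congrArg (enum u v) h; rwa [enum_idxOf, enum_idxOf] at this)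
  hac h := D.hac (by have := congrArg (enum u v) h; rwa [enum_idxOf, enum_idxOf] at this)
  had h := D.had (by have := congrArg (enum u v) h; rwa [enum_idxOf, enum_idxOf] at this)
  hbc h := D.hbc (by have := congrArg (enum u v) h; rwa [enum_idxOf, enum_idxOf] at this)
  hbd h := D.hbd (by have := congrArg (enum u v) h; rwa [enum_idxOf, enum_idxOf] at this)
  hcd h := D.hcd (by have := congrArg (enum u v) h; rwa [enum_idxOf, enum_idxOf] at this)

omit [Fintype σ] [DecidableEq σ] in
/-- The letter at the relation index `a` is `α`. [folklore] -/
theorem RelData.enum_a : enum u v D.idx.a = D.α := enum_idxOf u v _ _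
omit [Fintype σ] [DecidableEq σ] in
/-- The letter at the relation index `b` is `β`. [folklore] -/
theorem RelData.enum_b : enum u v D.idx.b = D.β := enum_idxOf u v _ _
omit [Fintype σ] [DecidableEq σ] in
/-- The letter at the relation index `c` is `γ`. [folklore] -/
theorem RelData.enum_c : enum u v D.idx.c = D.γ := enum_idxOf u v _ _
omit [Fintype σ] [DecidableEq σ] in
/-- The letter at the relation index `d` is `δ`. [folklore] -/
theorem RelData.enum_d : enum u v D.idx.d = D.δ := enum_idxOf u v _ _

/-- **The refined planar push-forward** (`ℕ²`-Riesz refinement of the relation):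
`Z₁ ↦ α ⊓ γ`, `Z₂ ↦ β ⊓ δ`, `W₁ ↦ α - α ⊓ γ`, `W₂ ↦ γ - α ⊓ γ`, other letters unchanged. [folklore] -/
def RelData.E' (i : Fin (sE u v)) : Expo :=
  if i = D.idx.a then D.α ⊓ D.γ else if i = D.idx.b then D.β ⊓ D.δ
  else if i = D.idx.c then D.α - D.α ⊓ D.γ else if i = D.idx.d then D.γ - D.α ⊓ D.γ else enum u v i

omit [Fintype σ] [DecidableEq σ] in
/-- The refined push-forward at `a` (`Z₁`): `α ⊓ γ`. [folklore] -/
theorem RelData.E'_a : D.E' D.idx.a = D.α ⊓ D.γ := by unfold RelData.E'; rw [if_pos rfl]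
omit [Fintype σ] [DecidableEq σ] in
/-- The refined push-forward at `b` (`Z₂`): `β ⊓ δ`. [folklore] -/
theorem RelData.E'_b : D.E' D.idx.b = D.β ⊓ D.δ := by unfold RelData.E'; rw [if_neg D.idx.hab.symm, if_pos rfl]
omit [Fintype σ] [DecidableEq σ] in
/-- The refined push-forward at `c` (`W₁`): `α - α ⊓ γ`. [folklore] -/
theorem RelData.E'_c : D.E' D.idx.c = D.α - D.α ⊓ D.γ := by
  unfold RelData.E'; rw [if_neg D.idx.hac.symm, if_neg D.idx.hbc.symm, if_pos rfl]
omit [Fintype σ] [DecidableEq σ] in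
/-- The refined push-forward at `d` (`W₂`): `γ - α ⊓ γ`. [folklore] -/
theorem RelData.E'_d : D.E' D.idx.d = D.γ - D.α ⊓ D.γ := by
  unfold RelData.E'; rw [if_neg D.idx.had.symm, if_neg D.idx.hbd.symm, if_neg D.idx.hcd.symm, if_pos rfl]
omit [Fintype σ] [DecidableEq σ] in
/-- The refined push-forward agrees with `enum` away from the four relation indices. [folklore] -/
theorem RelData.E'_other (i : Fin (sE u v)) (ha : i ≠ D.idx.a) (hb : i ≠ D.idx.b) (hc : i ≠ D.idx.c) (hd : i ≠ D.idx.d) :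
    D.E' i = enum u v i := by
  unfold RelData.E'; rw [if_neg ha, if_neg hb, if_neg hc, if_neg hd]

omit [Fintype σ] [DecidableEq σ] in
/-- The four Riesz identities: the refined push-forward composed with the Segre substitution is the letter map. [folklore] -/
theorem RelData.piE_E'_segM (i : Fin (sE u v)) : piE D.E' (segM D.idx i) = enum u v i := by
  have hrel : ∀ k, D.α k + D.β k = D.γ k + D.δ k := fun k => by
    have := DFunLike.congr_fun D.hrel k
    simpa only [Finsupp.add_apply] using this
  have hsum : ∀ p q : Fin (sE u v), piE D.E' (Finsupp.single p 1 + Finsupp.single q 1) = D.E' p + D.E' q := by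
    intro p q
    rw [piE_eq_piT, piT_add, piT_single, piT_single, one_smul, one_smul]
  by_cases hia : i = D.idx.a
  · subst hia
    rw [segM_a, hsum, D.E'_a, D.E'_c, D.enum_a]
    ext k
    simp only [Finsupp.add_apply, Finsupp.inf_apply, Finsupp.tsub_apply]
    omega
  by_cases hib : i = D.idx.b
  · subst hib
    rw [segM_b, hsum, D.E'_b, D.E'_d, D.enum_b]
    ext k
    simp only [Finsupp.add_apply, Finsupp.inf_apply, Finsupp.tsub_apply]
    have := hrel k
    omega
  by_cases hic : i = D.idx.c
  · subst hic
    rw [segM_c, hsum, D.E'_a, D.E'_d, D.enum_c]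
    ext k
    simp only [Finsupp.add_apply, Finsupp.inf_apply, Finsupp.tsub_apply]
    omega
  by_cases hid : i = D.idx.d
  · subst hid
    rw [segM_d, hsum, D.E'_b, D.E'_c, D.enum_d]
    ext k
    simp only [Finsupp.add_apply, Finsupp.inf_apply, Finsupp.tsub_apply]
    have := hrel k
    omega
  rw [segM_other D.idx i hia hib hic hid, piE_eq_piT, piT_single, one_smul, D.E'_other i hia hib hic hid]

omit [Fintype σ] [DecidableEq σ] in
/-- On exponents: refined push-forward ∘ Segre = letter push-forward. [folklore] -/
theorem RelData.piE_E'_piT (L : Fin (sE u v) →₀ ℕ) : piE D.E' (piT (segM D.idx) L) = piE (enum u v) L := by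
  have hM : (fun i => piT D.E' (segM D.idx i)) = enum u v := by
    funext i
    rw [← piE_eq_piT]
    exact D.piE_E'_segM i
  rw [piE_eq_piT, piE_eq_piT, piT_piT, hM]

omit [Fintype σ] [DecidableEq σ] in
/-- On polynomials: refined push-forward ∘ Segre = letter push-forward. [folklore] -/
theorem RelData.phi_E'_phiT (H : MvPolynomial (Fin (sE u v)) ℂ) : phi D.E' (phiT (segM D.idx) H) = phi (enum u v) H := by
  have hM : (fun i => piT D.E' (segM D.idx i)) = enum u v := by
    funext i
    rw [← piE_eq_piT]
    exact D.piE_E'_segM i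
  rw [phi_eq_phiT, phi_eq_phiT, phiT_phiT, hM]

/-- The Segre lift of the chain difference. [folklore] -/
def RelData.GT : MvPolynomial (Fin (sE u v)) ℂ := phiT (segM D.idx) (liftG (cU u v) (cV u v))

omit [Fintype σ] [DecidableEq σ] in
/-- Its refined push-forward is the planar difference of products. [folklore] -/
theorem RelData.phi_GT : phi D.E' D.GT = tailDiff u v := by
  unfold RelData.GT
  rw [D.phi_E'_phiT, phi_liftG]

omit [Fintype σ] [DecidableEq σ] in
/-- Support points of the Segre lift are balanced toric images of chain-support multisets. [folklore] -/
theorem RelData.exists_of_mem_support_GT (x : Fin (sE u v) →₀ ℕ) (hx : x ∈ D.GT.support) :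
    ∃ L ∈ (liftG (cU u v) (cV u v)).support, piT (segM D.idx) L = x :=
  exists_of_mem_support_phiT (segM D.idx) _ x hx

omit [Fintype σ] [DecidableEq σ] in
/-- **Injectivity from rank-one coincidences.** [folklore] -/
theorem RelData.injOn_of_rankOne (hu : ∀ j, coeff 0 (u j) = 0) (hv : ∀ j, coeff 0 (v j) = 0)
    (hR : RankOneCoincidences (fun j => (u j).support ∪ (v j).support)
      (Finsupp.single D.γ 1 + Finsupp.single D.δ 1) (Finsupp.single D.α 1 + Finsupp.single D.β 1)) :
    Set.InjOn (piE D.E') ↑D.GT.support := by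
  classical
  set A : Fin m → Finset Expo := fun j => (u j).support ∪ (v j).support with hA
  have hcU : ∀ j i, cU u v j i ≠ 0 → enum u v i ∈ A j := fun j i h =>
    Finset.mem_union_left _ (mem_support_iff.mpr h)
  have hcV : ∀ j i, cV u v j i ≠ 0 → enum u v i ∈ A j := fun j i h =>
    Finset.mem_union_right _ (mem_support_iff.mpr h)
  have key : ∀ κ ∈ (liftG (cU u v) (cV u v)).support,
      ∃ a ∈ tuples A, ∑ j, a j = piE (enum u v) κ ∧ msetT a = Finsupp.mapDomain (enum u v) κ := by
    intro κ hκ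
    unfold liftG at hκ
    rcases Finset.mem_union.1 (support_sub _ _ _ hκ) with h | h
    · exact tuple_of_mem_support_prod u v hu hv A (cU u v) hcU κ h
    · exact tuple_of_mem_support_prod u v hu hv A (cV u v) hcV κ h
  -- the relation upstairs
  set ρp : Fin (sE u v) →₀ ℕ := Finsupp.single D.idx.c 1 + Finsupp.single D.idx.d 1 with hρp
  set ρm : Fin (sE u v) →₀ ℕ := Finsupp.single D.idx.a 1 + Finsupp.single D.idx.b 1 with hρm
  have hmp : Finsupp.mapDomain (enum u v) ρp = Finsupp.single D.γ 1 + Finsupp.single D.δ 1 := by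
    rw [hρp, Finsupp.mapDomain_add, Finsupp.mapDomain_single, Finsupp.mapDomain_single, D.enum_c, D.enum_d]
  have hmm : Finsupp.mapDomain (enum u v) ρm = Finsupp.single D.α 1 + Finsupp.single D.β 1 := by
    rw [hρm, Finsupp.mapDomain_add, Finsupp.mapDomain_single, Finsupp.mapDomain_single, D.enum_a, D.enum_b]
  have hπρ : piT (segM D.idx) ρp = piT (segM D.idx) ρm := by
    rw [hρp, hρm, piT_add, piT_add, piT_single, piT_single, piT_single, piT_single, one_smul, one_smul, one_smul,
      one_smul, segM_rel]
  have hmapk : ∀ (k : ℕ) (L ρ : Fin (sE u v) →₀ ℕ),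
      Finsupp.mapDomain (enum u v) (L + k • ρ) = Finsupp.mapDomain (enum u v) L + k • Finsupp.mapDomain (enum u v) ρ := by
    intro k L ρ
    rw [Finsupp.mapDomain_add]
    congr 1
    exact map_nsmul (Finsupp.mapDomain.addMonoidHom (enum u v)) k ρ
  -- cancellation upstairs
  have cancel : ∀ (k : ℕ) (L L' : Fin (sE u v) →₀ ℕ), L + k • ρp = L' + k • ρm →
      piT (segM D.idx) L = piT (segM D.idx) L' := by
    intro k L L' h
    have := congrArg (piT (segM D.idx)) h
    rw [piT_add, piT_add, piT_nsmul, piT_nsmul, hπρ] at this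
    exact add_right_cancel this
  intro x hx x' hx' hπ
  obtain ⟨L, hL, rfl⟩ := D.exists_of_mem_support_GT x hx
  obtain ⟨L', hL', rfl⟩ := D.exists_of_mem_support_GT x' hx'
  rw [D.piE_E'_piT, D.piE_E'_piT] at hπ
  obtain ⟨a, ha, haS, haM⟩ := key L hL
  obtain ⟨b, hb, hbS, hbM⟩ := key L' hL'
  obtain ⟨k, hk⟩ := hR a ha b hb (by rw [haS, hbS]; exact hπ)
  rw [haM, hbM, ← hmp, ← hmm, ← hmapk, ← hmapk, ← hmapk, ← hmapk] at hk
  rcases hk with hk | hk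
  · exact cancel k L L' (Finsupp.mapDomain_injective (enum_injective u v) hk)
  · exact (cancel k L' L (Finsupp.mapDomain_injective (enum_injective u v) hk)).symm

omit [Fintype σ] [DecidableEq σ] in
/-- Visible points lift to strict `ξ`-maxima of the Segre-lifted support (under injectivity). [folklore] -/
theorem RelData.lifted_of_visible (hinj : Set.InjOn (piE D.E') ↑D.GT.support) (ξ : Fin 2 → ℝ) (l : Expo)
    (htop : IsStrictTop ξ ↑(tailDiff u v).support l) :
    ∃ x₀ : Fin (sE u v) →₀ ℕ, x₀ ∈ D.GT.support ∧ piE D.E' x₀ = l ∧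
      ∀ x ∈ D.GT.support, x ≠ x₀ → wt ξ (piE D.E' x) < wt ξ l := by
  have hsupp : tailDiff u v = phi D.E' D.GT := D.phi_GT.symm
  obtain ⟨hl, hlt⟩ := htop
  have hl' : l ∈ (phi D.E' D.GT).support := by rw [← hsupp]; exact hl
  obtain ⟨x₀, hx₀, hπ⟩ := exists_of_mem_support_phi D.E' _ l hl'
  refine ⟨x₀, hx₀, hπ, fun x hx hne => ?_⟩
  have hcoeff : coeff (piE D.E' x) (tailDiff u v) ≠ 0 := by
    rw [hsupp, coeff_phi_of_injOn D.E' _ hinj x hx]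
    exact mem_support_iff.mp hx
  have hneπ : piE D.E' x ≠ l := fun h => hne (hinj hx hx₀ (h.trans hπ.symm))
  exact hlt _ (mem_support_iff.mpr hcoeff) hneπ

end SegrePlanar

end Summit.ValiantsHypothesis.ValiantsHypothesis.Theorems.NewtonUnitEquations.TwoProducts.PermutationType

end
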